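import Literature.Topology.FourManifolds.SphereCorePrimitive
import HarnessLib

/-!
# The complement of a half-tube of a framed sphere is taut in the external collar:
# `K = incl(W ∖ φ(Sᵏ × ½Bˡ⁺¹))` is a deformation retract of `X = ExtCollar W ∖ incl S`

Topic `Literature/Topology/FourManifolds`; groundwork for Kervaire–Milnor's **Lemma 5.8**
(*Groups of homotopy spheres I*, Ann. of Math. (2) 77 (1963), pp. 516–518) in the reduced form
`(ISO)` of `SphereSurgeryOddMiddleRank.lean` (the isotropy of the torus of a spherical
modification), for the fact seat of
`Literature.Topology.FourManifolds.HomotopySphere.boundsContractible_of_nullCobordism_isStablyParallelizable_four`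
(Thm. 5.1 at `k = 2`). Everything here is **proved**; no definition and no named fact is
introduced (D-0026).

Kervaire–Milnor work with the compact manifold with boundary
`M₀ = M ∖ Interior φ(Sᵏ × Dˡ⁺¹)`, `bM₀ = bM + φ(Sᵏ × Sˡ)` (Lemma 5.6, p. 514), to which Thom's
isotropy theorem (the kernel of `Hₖ(bM₀) → Hₖ(M₀)` is isotropic; R. Thom, Ann. Sci. ENS 69 (1952),
Thm. V.7/V.10) is to be applied. The tree has no atlas on such a complement; instead, exactly as
Lefschetz duality for `(W, ∂W)` was derived in `LefschetzDualityProofs.lean`, the duality of `M₀`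
will be Čech–Alexander–Poincaré duality (H. Miller, *Lectures on Algebraic Topology* (2020),
Thm. 37.1; tree: `HomologicalOrientation.bijective_cechCap_classAlong`) along the COMPACT SET
`K = incl(W ∖ φ(Sᵏ × ½Bˡ⁺¹))` in the boundaryless manifold `X = ExtCollar W ∖ incl S` (the external
collar of Hatcher, *Algebraic Topology* (2002), proof of Prop. 3.42, with the core sphere removed).
For that, `K` must be **taut** in `X` (Spanier, *Algebraic Topology* (1966), Thm. 6.1.10: Čech and
singular cohomology of `K` agree), which this file proves in the strong form used by the tree
(`Cech.RetractionNhds`): `X` retracts onto `K` — squeeze the external collar vertically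
(`ExtCollar.squeeze`) and push the punctured half-tube `φ(Sᵏ × (½Bˡ⁺¹ ∖ 0))` radially onto the
torus `φ(Sᵏ × ½Sˡ)` — and every neighbourhood of `K` contains a standard one,
`{height > -ε} ∩ {radius > ½ - ε}`, which the deformation preserves.

* `FramedSphereFamily.isCompact_image_incl_compl_halfTubes`, `image_incl_compl_halfTubes_subset`
  — `K` is compact and misses `incl S`;
* `FramedSphereFamily.exists_retraction_retractionNhds_compl_halfTubes` — **main**: in
  `X = ExtCollar W ∖ incl S` there is a retraction `r : X → K` (`r|_K = id`), and `K` carries a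
  tautness datum `Cech.RetractionNhds` (with retracting neighbourhood all of `X`).

## References

* M. Kervaire, J. Milnor, *Groups of homotopy spheres I*, Ann. of Math. (2) 77 (1963), Lemma 5.6
  (p. 514: `M₀`), Lemma 5.8 (pp. 516–518). doi:10.2307/1970128 [KervaireMilnorAnnals1963]
* E. H. Spanier, *Algebraic Topology*, Springer 1981, Ch. 6 §1, Thm. 10. [Spanier1981]
* A. Hatcher, *Algebraic Topology*, CUP 2002, §3.3, proof of Prop. 3.42 (p. 253). [HatcherAT2002]
* H. Miller, *Lectures on Algebraic Topology*, World Scientific 2020, Thm. 37.1. [Miller2020]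
-/

noncomputable section

open scoped Manifold ContDiff Topology ContinuousMap unitInterval
open Set Function Metric Topology
open Literature.AlgebraicTopology.SingularHomology

namespace Literature.Topology.FourManifolds

namespace FramedSphereFamily

open ExtCollar

variable {n k l : ℕ} {W : Type} [TopologicalSpace W] [ChartedSpace (EuclideanHalfSpace (n + 1)) W]
  (ν : FramedSphereFamily (𝓡∂ (n + 1)) W Unit k (l + 1))

/-! ### The compact set `K = incl(W ∖ φ(Sᵏ × ½B))` -/

/-- `K = incl(W ∖ ⋃ φ(Sᵏ × ½B))` is compact for compact `W`. [folklore] -/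
theorem isCompact_image_incl_compl_halfTubes [CompactSpace W] :
    IsCompact (incl n '' ν.halfTubesᶜ : Set (ExtCollar n W)) :=
  (ν.isOpen_halfTubes.isClosed_compl.isCompact).image continuous_incl

/-- `K` misses `incl S`. [folklore] -/
theorem image_incl_compl_halfTubes_subset :
    incl n '' ν.halfTubesᶜ ⊆ (incl n '' ν.cores : Set (ExtCollar n W))ᶜ := by
  rintro _ ⟨w, hw, rfl⟩ ⟨w', hw', h⟩
  exact hw (incl_injective h ▸ ν.cores_subset_halfTubes hw')

/-- A point of `W ∖ S` in the closed half-tube is `φ(u, w)` with `0 < ‖w‖ ≤ ½`; in particular the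
base point of a point of `X = ExtCollar W ∖ incl S` of height `0`. [folklore] -/
theorem norm_pos_of_apply_not_mem_cores {q : (Metric.sphere (0 : EuclideanSpace ℝ (Fin (k + 1))) 1) ×
      EuclideanSpace ℝ (Fin (l + 1))} (hq : ν.toFun () q ∉ ν.cores) : 0 < ‖q.2‖ := by
  rw [norm_pos_iff]
  intro h0
  apply hq
  rw [show q = (q.1, 0) from Prod.ext rfl h0]
  exact ν.sphere_mem_cores () q.1

/-! ### The deformation of `X` onto `K`, and the tautness datum -/

/-- **`K = incl(W ∖ φ(Sᵏ × ½B))` is a retract of `X = ExtCollar W ∖ incl S`, and is taut in it.**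
There is a retraction `r : X → K` and a tautness datum (`Cech.RetractionNhds`, Spanier 1966,
Thm. 6.1.10) for `K ⊆ X` whose retracting neighbourhood is all of `X`: the deformation
`H_t` squeezes the external collar vertically (`ExtCollar.squeeze (1 - t)`) and pushes the punctured
half-tube `incl φ(u, w)`, `0 < ‖w‖ ≤ ½`, radially to `incl φ(u, ((1-t)‖w‖ + t/2) w/‖w‖)`; it fixes
`K`, ends in `K`, and preserves the standard neighbourhoods `{height > -ε} ∩ {‖w‖ > ½ - ε}` of `K`,
a basis of neighbourhoods of the compact `K` (tube lemma, `ExtCollar.exists_collarNhd_subset` for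
the collar and compactness of `Sᵏ × ½D` for the tube). (`W` compact smooth with boundary, so that
the tube lies in the interior, `FramedSphereFamily.apply_not_mem_boundary`.)
[cite: Spanier1981, Ch. 6 §1, Thm. 10] [cite: HatcherAT2002, §3.3 p. 253] -/
theorem exists_retraction_retractionNhds_compl_halfTubes [T2Space W] [CompactSpace W]
    [IsManifold (𝓡∂ (n + 1)) ∞ W] (hkl : k + l = n) :
    ∃ r : C(↥((incl n '' ν.cores : Set (ExtCollar n W))ᶜ),
        ↥{x : ↥((incl n '' ν.cores : Set (ExtCollar n W))ᶜ) | (x : ExtCollar n W) ∈ incl n '' ν.halfTubesᶜ}),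
      (∀ (x : ↥((incl n '' ν.cores : Set (ExtCollar n W))ᶜ))
        (hx : (x : ExtCollar n W) ∈ incl n '' ν.halfTubesᶜ), r x = ⟨x, hx⟩) ∧
      Nonempty (Cech.RetractionNhds
        {x : ↥((incl n '' ν.cores : Set (ExtCollar n W))ᶜ) | (x : ExtCollar n W) ∈ incl n '' ν.halfTubesᶜ}) := by
  -- notation
  let φ := ν.toFun ()
  have hφ : IsOpenEmbedding φ := ν.isOpenEmbedding_toFun ()
  let e := ν.toHomeo ()
  let S' : Set (ExtCollar n W) := incl n '' ν.cores
  let X := ↥(S'ᶜ)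
  let K : Set (ExtCollar n W) := incl n '' ν.halfTubesᶜ
  let K' : Set X := {x | (x : ExtCollar n W) ∈ K}
  -- the closed half-tube `D = φ(Sᵏ × ½D)` and its complement
  let D : Set W := φ '' {q | ‖q.2‖ ≤ 2⁻¹}
  have hDc : IsCompact D :=
    ((isCompact_univ.prod (isCompact_closedBall (0 : EuclideanSpace ℝ (Fin (l + 1)))
      2⁻¹)).of_isClosed_subset (isClosed_le (continuous_norm.comp continuous_snd) continuous_const)
      (fun q hq => ⟨mem_univ _, mem_closedBall_zero_iff.2 hq⟩)).image (ν.continuous ())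
  have hDcl : IsClosed D := hDc.isClosed
  have hhalf : ν.halfTubes = φ '' {q | ‖q.2‖ < 2⁻¹} := by
    ext x
    simp only [FramedSphereFamily.halfTubes, mem_iUnion]
    constructor
    · rintro ⟨i, hi⟩
      rw [Subsingleton.elim i ()] at hi
      exact hi
    · exact fun h => ⟨(), h⟩
  have hDint : Disjoint D ((𝓡∂ (n + 1)).boundary W) :=
    Set.disjoint_left.2 (by rintro _ ⟨q, -, rfl⟩ hb; exact ν.apply_not_mem_boundary hkl () q hb)
  have hrange : Disjoint (range φ) ((𝓡∂ (n + 1)).boundary W) :=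
    Set.disjoint_left.2 (by rintro _ ⟨q, rfl⟩ hb; exact ν.apply_not_mem_boundary hkl () q hb)
  -- points of `X` over the tube: base `φ q` with `q.2 ≠ 0`, height `0`
  have hX_q : ∀ x : X, ∀ q, base (x : ExtCollar n W) = φ q → 0 < ‖q.2‖ := by
    intro x q hq
    refine ν.norm_pos_of_apply_not_mem_cores fun hc => x.2 ⟨φ q, hc, ?_⟩
    rw [← hq]
    exact incl_base_of_height_eq_zero (height_eq_zero_of_base_not_mem fun hb =>
      Set.disjoint_left.1 hrange ⟨q, hq.symm ▸ rfl⟩ (hq ▸ hb))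
  have hX_h : ∀ x : X, ∀ q, base (x : ExtCollar n W) = φ q → height (x : ExtCollar n W) = 0 := by
    intro x q hq
    exact height_eq_zero_of_base_not_mem fun hb =>
      Set.disjoint_left.1 hrange ⟨q, rfl⟩ (hq ▸ hb)
  -- the radial factor `ρ t s = (1 - t) + t / (2 s)` (`new radius = (1 - t) s + t / 2`)
  let ρ : ℝ → ℝ → ℝ := fun t s => (1 - t) + t * (2 * s)⁻¹
  have hρ_pos : ∀ t ∈ I, ∀ s, 0 < s → 0 < ρ t s := by
    rintro t ⟨ht0, ht1⟩ s hs
    change 0 < (1 - t) + t * (2 * s)⁻¹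
    rcases eq_or_lt_of_le ht1 with rfl | h1
    · norm_num; positivity
    · have : 0 ≤ t * (2 * s)⁻¹ := by positivity
      linarith
  have hρ_mul : ∀ t s, 0 < s → ρ t s * s = (1 - t) * s + t * 2⁻¹ := by
    intro t s hs
    change ((1 - t) + t * (2 * s)⁻¹) * s = _
    field_simp
  -- the radial branch, on the whole of `ℝ × (Sᵏ × ℝˡ⁺¹)`
  let rad : ℝ × ((Metric.sphere (0 : EuclideanSpace ℝ (Fin (k + 1))) 1) ×
      EuclideanSpace ℝ (Fin (l + 1))) → ExtCollar n W :=
    fun p => incl n (φ (p.2.1, ρ p.1 ‖p.2.2‖ • p.2.2))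
  have hrad_cont : ContinuousOn rad {p | p.2.2 ≠ 0} := by
    refine continuous_incl.comp_continuousOn ((ν.continuous ()).comp_continuousOn ?_)
    refine (continuous_fst.comp continuous_snd).continuousOn.prodMk ?_
    have hρc : ContinuousOn (fun p : ℝ × ((Metric.sphere (0 : EuclideanSpace ℝ (Fin (k + 1))) 1) ×
        EuclideanSpace ℝ (Fin (l + 1))) => ρ p.1 ‖p.2.2‖) {p | p.2.2 ≠ 0} := by
      change ContinuousOn (fun p : ℝ × (_ × EuclideanSpace ℝ (Fin (l + 1))) =>
        (1 - p.1) + p.1 * (2 * ‖p.2.2‖)⁻¹) {p | p.2.2 ≠ 0}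
      refine ((continuous_const.sub continuous_fst).continuousOn).add
        (continuous_fst.continuousOn.mul ?_)
      refine ((continuous_const.mul (continuous_norm.comp (continuous_snd.comp
        continuous_snd))).continuousOn).inv₀ fun p hp => ?_
      exact mul_ne_zero two_ne_zero (norm_ne_zero_iff.2 hp)
    have hwc : ContinuousOn (fun p : ℝ × ((Metric.sphere (0 : EuclideanSpace ℝ (Fin (k + 1))) 1) ×
        EuclideanSpace ℝ (Fin (l + 1))) => p.2.2) {p | p.2.2 ≠ 0} :=
      (continuous_snd.comp continuous_snd).continuousOn
    exact hρc.smul hwc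
  -- the deformation, on `ℝ × ExtCollar`
  classical
  let Hf : ℝ × ExtCollar n W → ExtCollar n W := fun p =>
    if base p.2 ∈ D then rad (p.1, e.symm (base p.2)) else ExtCollar.squeeze (1 - p.1) p.2
  -- its values on the two pieces
  have hHf_tube : ∀ t (x : ExtCollar n W) q, base x = φ q → ‖q.2‖ ≤ 2⁻¹ →
      Hf (t, x) = incl n (φ (q.1, ρ t ‖q.2‖ • q.2)) := by
    intro t x q hq hq2
    have hD : base x ∈ D := ⟨q, hq2, hq.symm⟩
    simp only [Hf, hD, if_true, rad]
    rw [hq]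
    change incl n (φ (((ν.toHomeo ()).symm (ν.toFun () q)).1,
      ρ t ‖((ν.toHomeo ()).symm (ν.toFun () q)).2‖ • ((ν.toHomeo ()).symm (ν.toFun () q)).2)) = _
    rw [toHomeo_symm_apply]
  have hHf_off : ∀ t (x : ExtCollar n W), base x ∉ φ '' {q | ‖q.2‖ < 2⁻¹} →
      Hf (t, x) = ExtCollar.squeeze (1 - t) x := by
    intro t x hx
    by_cases hD : base x ∈ D
    · -- on the torus `‖q.2‖ = ½` both formulas give `x`
      obtain ⟨q, hq2, hq⟩ := hD
      have hq2' : ‖q.2‖ = 2⁻¹ := le_antisymm hq2 (not_lt.1 fun h => hx ⟨q, h, hq⟩)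
      have hh : height x = 0 := height_eq_zero_of_base_not_mem fun hb =>
        Set.disjoint_left.1 hrange ⟨q, hq⟩ hb
      rw [hHf_tube t x q hq.symm hq2, ExtCollar.squeeze_of_height_eq_zero _ hh]
      have hρ1 : ρ t ‖q.2‖ = 1 := by
        change (1 - t) + t * (2 * ‖q.2‖)⁻¹ = 1
        rw [hq2']; norm_num
      rw [hρ1, one_smul, Prod.mk.eta, hq]
      exact incl_base_of_height_eq_zero hh
    · simp only [Hf, hD, if_false]
  -- continuity of the two branches
  have hS'cl : IsClosed S' := (ν.isCompact_cores.image continuous_incl).isClosed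
  let A : Set (ℝ × ExtCollar n W) := {p | base p.2 ∈ D}
  let B : Set (ℝ × ExtCollar n W) := {p | base p.2 ∉ φ '' {q | ‖q.2‖ < 2⁻¹}}
  have hopen_half : IsOpen (φ '' {q | ‖q.2‖ < 2⁻¹}) :=
    hφ.isOpenMap _ (isOpen_lt (continuous_norm.comp continuous_snd) continuous_const)
  have hcontA : ContinuousOn Hf (A ∩ {p | p.2 ∉ S'}) := by
    have heq : EqOn (fun p => rad (p.1, e.symm (base p.2))) Hf (A ∩ {p | p.2 ∉ S'}) := by
      intro p hp
      have hD : base p.2 ∈ D := hp.1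
      simp only [Hf, hD, if_true]
    refine ContinuousOn.congr ?_ heq.symm
    refine hrad_cont.comp (continuous_fst.continuousOn.prodMk ?_) ?_
    · refine e.continuousOn_symm.comp (continuous_base.comp continuous_snd).continuousOn ?_
      intro p hp
      rw [toHomeo_target]
      obtain ⟨q, -, hq⟩ := hp.1
      exact ⟨q, hq⟩
    · intro p hp
      obtain ⟨q, hq2, hq⟩ := hp.1
      change (e.symm (base p.2)).2 ≠ 0
      rw [← hq]
      change ((ν.toHomeo ()).symm (ν.toFun () q)).2 ≠ 0
      rw [toHomeo_symm_apply]
      exact norm_pos_iff.1 (hX_q ⟨p.2, hp.2⟩ q hq.symm)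
  have hcontB : ContinuousOn Hf B := by
    refine ContinuousOn.congr ?_ (fun p hp => hHf_off p.1 p.2 hp)
    exact (ExtCollar.continuous_squeeze.comp ((continuous_const.sub continuous_fst).prodMk
      continuous_snd)).continuousOn
  -- values stay in `X`
  have hHf_mem : ∀ t ∈ I, ∀ x : X, Hf (t, x) ∈ S'ᶜ := by
    intro t ht x
    by_cases hD : base (x : ExtCollar n W) ∈ D
    · obtain ⟨q, hq2, hq⟩ := hD
      rw [hHf_tube t x q hq.symm hq2]
      rintro ⟨w, hw, hw'⟩
      have hw'' : w = φ (q.1, ρ t ‖q.2‖ • q.2) := incl_injective hw'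
      have hpos : 0 < ‖q.2‖ := hX_q x q hq.symm
      have hne : ρ t ‖q.2‖ • q.2 ≠ 0 := smul_ne_zero (hρ_pos t ht _ hpos).ne' (norm_pos_iff.1 hpos)
      have hc : φ (q.1, ρ t ‖q.2‖ • q.2) ∈ ν.cores := hw'' ▸ hw
      exact (ν.apply_mem_complement () q.1 hne) hc
    · have hx : base (x : ExtCollar n W) ∉ φ '' {q | ‖q.2‖ < 2⁻¹} := fun h => hD (by
        obtain ⟨q, hq, hq'⟩ := h; exact ⟨q, (show ‖q.2‖ < 2⁻¹ from hq).le, hq'⟩)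
      rw [hHf_off t x hx]
      exact ν.mapsTo_squeeze_compl_cores hkl (1 - t) x.2
  -- the deformation as a continuous map `I × X → X`
  let H : C(I × X, X) :=
    ⟨fun p => ⟨Hf (p.1, p.2), hHf_mem p.1 p.1.2 p.2⟩, by
      refine Continuous.subtype_mk ?_ _
      -- closed cover of `I × X` by the preimages of `A` and `B`
      let ψ : I × X → ℝ × ExtCollar n W := fun p => ((p.1 : ℝ), (p.2 : ExtCollar n W))
      have hψ : Continuous ψ := (continuous_subtype_val.comp continuous_fst).prodMk
        (continuous_subtype_val.comp continuous_snd)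
      have hA' : IsClosed (ψ ⁻¹' A) := (hDcl.preimage (continuous_base.comp continuous_snd)).preimage hψ
      have hB' : IsClosed (ψ ⁻¹' B) :=
        ((hopen_half.preimage (continuous_base.comp continuous_snd)).isClosed_compl).preimage hψ
      have hcov : ψ ⁻¹' A ∪ ψ ⁻¹' B = univ := by
        refine eq_univ_of_forall fun p => ?_
        by_cases h : base (p.2 : ExtCollar n W) ∈ D
        · exact Or.inl h
        · refine Or.inr fun h' => h ?_
          obtain ⟨q, hq, hq'⟩ := h'
          exact ⟨q, (show ‖q.2‖ < 2⁻¹ from hq).le, hq'⟩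
      have h1 : ContinuousOn (Hf ∘ ψ) (ψ ⁻¹' A) :=
        hcontA.comp hψ.continuousOn fun p hp => ⟨hp, p.2.2⟩
      have h2 : ContinuousOn (Hf ∘ ψ) (ψ ⁻¹' B) := hcontB.comp hψ.continuousOn fun p hp => hp
      have h := h1.union_of_isClosed h2 hA' hB'
      rw [hcov] at h
      exact continuousOn_univ.1 h⟩
  have hH_apply : ∀ p : I × X, (H p : ExtCollar n W) = Hf (p.1, p.2) := fun p => rfl
  -- `H₀ = id`
  have hH0 : ∀ x : X, H (0, x) = x := by
    intro x
    apply Subtype.ext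
    rw [hH_apply]
    by_cases hD : base (x : ExtCollar n W) ∈ D
    · obtain ⟨q, hq2, hq⟩ := hD
      change Hf (0, x) = x
      rw [hHf_tube 0 x q hq.symm hq2]
      have hρ1 : ρ 0 ‖q.2‖ = 1 := by change (1 - 0) + 0 * (2 * ‖q.2‖)⁻¹ = 1; norm_num
      rw [hρ1, one_smul, Prod.mk.eta, hq]
      exact incl_base_of_height_eq_zero (hX_h x q hq.symm)
    · have hx : base (x : ExtCollar n W) ∉ φ '' {q | ‖q.2‖ < 2⁻¹} := fun h => hD (by
        obtain ⟨q, hq, hq'⟩ := h; exact ⟨q, (show ‖q.2‖ < 2⁻¹ from hq).le, hq'⟩)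
      change Hf (0, x) = x
      rw [hHf_off 0 x hx, sub_zero, squeeze_one]
  -- `H₁ ∈ K`
  have hH1 : ∀ x : X, (H (1, x) : ExtCollar n W) ∈ K := by
    intro x
    rw [hH_apply]
    by_cases hD : base (x : ExtCollar n W) ∈ D
    · obtain ⟨q, hq2, hq⟩ := hD
      change Hf (1, x) ∈ K
      rw [hHf_tube 1 x q hq.symm hq2]
      refine ⟨_, fun hmem => ?_, rfl⟩
      rw [apply_mem_halfTubes_iff] at hmem
      have hpos : 0 < ‖q.2‖ := hX_q x q hq.symm
      have : ‖ρ 1 ‖q.2‖ • q.2‖ = 2⁻¹ := by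
        rw [norm_smul, Real.norm_of_nonneg (hρ_pos 1 ⟨zero_le_one, le_rfl⟩ _ hpos).le, hρ_mul 1 _ hpos]
        norm_num
      rw [this] at hmem
      exact lt_irrefl _ hmem
    · have hx : base (x : ExtCollar n W) ∉ φ '' {q | ‖q.2‖ < 2⁻¹} := fun h => hD (by
        obtain ⟨q, hq, hq'⟩ := h; exact ⟨q, (show ‖q.2‖ < 2⁻¹ from hq).le, hq'⟩)
      change Hf (1, x) ∈ K
      rw [hHf_off 1 x hx, sub_self, ExtCollar.squeeze_zero]
      exact ⟨base (x : ExtCollar n W), fun hmem => hx (hhalf ▸ hmem), rfl⟩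
  -- `H_t` fixes `K`
  have hHK : ∀ (t : I) (x : X), (x : ExtCollar n W) ∈ K → H (t, x) = x := by
    intro t x hxK
    apply Subtype.ext
    rw [hH_apply]
    obtain ⟨w, hw, hwx⟩ := hxK
    have hx : base (x : ExtCollar n W) ∉ φ '' {q | ‖q.2‖ < 2⁻¹} := by
      rw [← hwx, base_incl]
      rintro ⟨q, hq, rfl⟩
      exact hw ((apply_mem_halfTubes_iff ν).2 hq)
    change Hf (t, x) = x
    rw [hHf_off t x hx]
    exact ExtCollar.squeeze_of_height_eq_zero _ (by rw [← hwx, height_incl])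
  -- the standard neighbourhoods `V ε = {height > -ε} ∩ {base ∉ φ(‖·‖ ≤ ½ - ε)}` are preserved
  let V : ℝ → Set X := fun ε =>
    {x | -ε < height (x : ExtCollar n W) ∧ base (x : ExtCollar n W) ∉ φ '' {q | ‖q.2‖ ≤ 2⁻¹ - ε}}
  have hV_open : ∀ ε, IsOpen (V ε) := by
    intro ε
    refine (isOpen_lt continuous_const (continuous_height.comp continuous_subtype_val)).inter ?_
    have hc : IsClosed (φ '' {q | ‖q.2‖ ≤ 2⁻¹ - ε}) := by
      refine IsCompact.isClosed ?_
      exact ((isCompact_univ.prod (isCompact_closedBall (0 : EuclideanSpace ℝ (Fin (l + 1)))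
        (2⁻¹ - ε))).of_isClosed_subset (isClosed_le (continuous_norm.comp continuous_snd)
          continuous_const) (fun q hq => ⟨mem_univ _, mem_closedBall_zero_iff.2 hq⟩)).image
        (ν.continuous ())
    exact (hc.preimage (continuous_base.comp continuous_subtype_val)).isOpen_compl
  have hKV : ∀ ε, 0 < ε → K' ⊆ V ε := by
    intro ε hε x hx
    obtain ⟨w, hw, hwx⟩ := hx
    refine ⟨by rw [← hwx, height_incl]; linarith, ?_⟩
    rw [← hwx, base_incl]
    rintro ⟨q, hq, rfl⟩
    exact hw ((apply_mem_halfTubes_iff ν).2 (by change ‖q.2‖ ≤ 2⁻¹ - ε at hq; linarith))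
  have hHV : ∀ ε (t : I) (x : X), x ∈ V ε → H (t, x) ∈ V ε := by
    intro ε t x hx
    obtain ⟨hxh, hxb⟩ := hx
    change -ε < height (Hf (t, x)) ∧ base (Hf (t, x)) ∉ φ '' {q | ‖q.2‖ ≤ 2⁻¹ - ε}
    by_cases hD : base (x : ExtCollar n W) ∈ D
    · obtain ⟨q, hq2, hq⟩ := hD
      rw [hHf_tube t x q hq.symm hq2, height_incl, base_incl]
      refine ⟨by have h0 := height_le (x : ExtCollar n W); linarith, ?_⟩
      rintro ⟨q', hq', hqq'⟩
      obtain rfl := ν.injective () hqq'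
      change ‖ρ t ‖q.2‖ • q.2‖ ≤ 2⁻¹ - ε at hq'
      have hpos : 0 < ‖q.2‖ := hX_q x q hq.symm
      rw [norm_smul, Real.norm_of_nonneg (hρ_pos t t.2 _ hpos).le, hρ_mul t _ hpos] at hq'
      apply hxb
      refine ⟨q, ?_, hq⟩
      change ‖q.2‖ ≤ 2⁻¹ - ε
      have ht0 : 0 ≤ (t : ℝ) := t.2.1
      have hs : ‖q.2‖ ≤ 2⁻¹ := hq2
      have hmono : ‖q.2‖ ≤ (1 - (t : ℝ)) * ‖q.2‖ + (t : ℝ) * 2⁻¹ := by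
        nlinarith [mul_nonneg ht0 (sub_nonneg.2 hs)]
      exact hmono.trans hq'
    · have hx : base (x : ExtCollar n W) ∉ φ '' {q | ‖q.2‖ < 2⁻¹} := fun h => hD (by
        obtain ⟨q, hq, hq'⟩ := h; exact ⟨q, (show ‖q.2‖ < 2⁻¹ from hq).le, hq'⟩)
      rw [hHf_off t x hx, ExtCollar.height_squeeze, ExtCollar.base_squeeze]
      refine ⟨?_, hxb⟩
      have hm0 : 0 ≤ max (1 - (t : ℝ)) 0 := le_max_right _ _
      have hm1 : max (1 - (t : ℝ)) 0 ≤ 1 := max_le (by linarith [t.2.1]) zero_le_one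
      have hh : height (x : ExtCollar n W) ≤ 0 := height_le _
      nlinarith
  -- every neighbourhood of `K` contains a standard one
  have hbasis : ∀ U : Set X, IsOpen U → K' ⊆ U → ∃ ε, 0 < ε ∧ V ε ⊆ U := by
    intro U hU hKU
    obtain ⟨U', hU', rfl⟩ := isOpen_induced_iff.1 hU
    -- the collar: `U' ∪ base⁻¹(halfTubes)` contains `incl W`
    have hWU : range (incl n) ⊆ U' ∪ base ⁻¹' ν.halfTubes := by
      rintro _ ⟨w, rfl⟩
      by_cases hw : w ∈ ν.halfTubes
      · exact Or.inr hw
      · have hxX : incl n w ∈ S'ᶜ := ν.image_incl_compl_halfTubes_subset ⟨w, hw, rfl⟩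
        exact Or.inl (hKU (show (⟨incl n w, hxX⟩ : X) ∈ K' from ⟨w, hw, rfl⟩))
    obtain ⟨ε₁, hε₁, hcollar⟩ := exists_collarNhd_subset
      (hU'.union (ν.isOpen_halfTubes.preimage continuous_base)) hWU
    -- the tube: a compactness argument on `F = {q | ‖q.2‖ ≤ ½, incl (φ q) ∉ U'}`
    let F : Set ((Metric.sphere (0 : EuclideanSpace ℝ (Fin (k + 1))) 1) ×
        EuclideanSpace ℝ (Fin (l + 1))) := {q | ‖q.2‖ ≤ 2⁻¹} ∩ (incl n ∘ φ) ⁻¹' U'ᶜ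
    have hFc : IsCompact F := by
      refine ((isCompact_univ.prod (isCompact_closedBall (0 : EuclideanSpace ℝ (Fin (l + 1)))
        2⁻¹)).of_isClosed_subset (isClosed_le (continuous_norm.comp continuous_snd)
          continuous_const) fun q hq => ⟨mem_univ _, mem_closedBall_zero_iff.2 hq⟩).inter_right ?_
      exact (hU'.isClosed_compl).preimage (continuous_incl.comp (ν.continuous ()))
    have hFlt : ∀ q ∈ F, ‖q.2‖ < 2⁻¹ := by
      rintro q ⟨hq, hqU⟩
      refine lt_of_le_of_ne hq fun heq => hqU ?_
      have hnot : φ q ∉ ν.halfTubes := fun h => by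
        rw [apply_mem_halfTubes_iff] at h; rw [heq] at h; exact lt_irrefl _ h
      have hxX : incl n (φ q) ∈ S'ᶜ := ν.image_incl_compl_halfTubes_subset ⟨φ q, hnot, rfl⟩
      exact hKU (show (⟨incl n (φ q), hxX⟩ : X) ∈ K' from ⟨φ q, hnot, rfl⟩)
    obtain ⟨ε₂, hε₂, htube⟩ : ∃ ε₂, 0 < ε₂ ∧ ∀ q : (Metric.sphere (0 : EuclideanSpace ℝ
        (Fin (k + 1))) 1) × EuclideanSpace ℝ (Fin (l + 1)),
        2⁻¹ - ε₂ < ‖q.2‖ → ‖q.2‖ ≤ 2⁻¹ → incl n (φ q) ∈ U' := by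
      rcases F.eq_empty_or_nonempty with hF | hF
      · refine ⟨2⁻¹, by norm_num, fun q _ hq2 => ?_⟩
        by_contra hqU
        have : q ∈ F := ⟨hq2, hqU⟩
        rw [hF] at this
        exact this
      · obtain ⟨q₀, hq₀, hmax⟩ := hFc.exists_isMaxOn hF (continuous_norm.comp continuous_snd).continuousOn
        refine ⟨2⁻¹ - ‖q₀.2‖, by linarith [hFlt q₀ hq₀], fun q hq hq2 => ?_⟩
        by_contra hqU
        have hqF : q ∈ F := ⟨hq2, hqU⟩
        have := hmax hqF
        change ‖q.2‖ ≤ ‖q₀.2‖ at this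
        linarith
    refine ⟨min ε₁ ε₂, lt_min hε₁ hε₂, fun x hx => ?_⟩
    obtain ⟨hxh, hxb⟩ := hx
    change (x : ExtCollar n W) ∈ U'
    rcases lt_or_eq_of_le (height_le (x : ExtCollar n W)) with hlt | h0
    · -- a collar point: in `U' ∪ base⁻¹(halfTubes)`, and not over the tube
      have hmem : (x : ExtCollar n W) ∈ collarNhd ε₁ := by
        rw [mem_collarNhd_iff]
        exact lt_of_le_of_lt (neg_le_neg (min_le_left ε₁ ε₂)) hxh
      rcases hcollar hmem with h | h
      · exact h
      · exfalso
        have hb := base_mem_boundary_of_height_lt hlt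
        have h' : base (x : ExtCollar n W) ∈ φ '' {q | ‖q.2‖ < 2⁻¹} := hhalf ▸ h
        obtain ⟨q, -, hq'⟩ := h'
        have hb' : φ q ∈ (𝓡∂ (n + 1)).boundary W := hq' ▸ hb
        exact ν.apply_not_mem_boundary hkl () q hb'
    · -- a point of height `0`: `x = incl (base x)`
      have hxe : (x : ExtCollar n W) = incl n (base (x : ExtCollar n W)) :=
        (incl_base_of_height_eq_zero h0).symm
      by_cases hT : base (x : ExtCollar n W) ∈ ν.halfTubes
      · have hT' : base (x : ExtCollar n W) ∈ φ '' {q | ‖q.2‖ < 2⁻¹} := hhalf ▸ hT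
        obtain ⟨q, hq, hq'⟩ := hT'
        have hgt : 2⁻¹ - ε₂ < ‖q.2‖ := by
          by_contra hle
          have hle' : ‖q.2‖ ≤ 2⁻¹ - ε₂ := not_lt.1 hle
          apply hxb
          exact ⟨q, by change ‖q.2‖ ≤ 2⁻¹ - min ε₁ ε₂; linarith [min_le_right ε₁ ε₂], hq'⟩
        rw [hxe, ← hq']
        exact htube q hgt (show ‖q.2‖ < 2⁻¹ from hq).le
      · have hxK : (⟨(x : ExtCollar n W), x.2⟩ : X) ∈ K' := ⟨_, hT, hxe.symm⟩
        exact hKU (by simpa using hxK)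
  -- the retraction and the tautness datum
  let r : C(X, ↥K') := ⟨fun x => ⟨H (1, x), hH1 x⟩, (H.continuous.comp
    (continuous_const.prodMk continuous_id)).subtype_mk _⟩
  have hr : ∀ (x : X) (hx : (x : ExtCollar n W) ∈ K), r x = ⟨x, hx⟩ := fun x hx =>
    Subtype.ext (hHK 1 x hx)
  refine ⟨r, hr, ⟨{ U₀ := univ
                    isOpen := isOpen_univ
                    subset := subset_univ _
                    r := r.comp ⟨Subtype.val, continuous_subtype_val⟩
                    retract := fun x hx => hr x hx
                    homotopic := fun U hU hKU _ => ?_ }⟩⟩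
  obtain ⟨ε, hε, hVU⟩ := hbasis U hU hKU
  refine ⟨V ε, hV_open ε, hKV ε hε, hVU, ⟨?_⟩⟩
  exact
    { toFun := fun p => ⟨H (p.1, (p.2 : X)), hVU (hHV ε p.1 p.2 p.2.2)⟩
      continuous_toFun := (H.continuous.comp (continuous_fst.prodMk
        (continuous_subtype_val.comp continuous_snd))).subtype_mk _
      map_zero_left := fun v => Subtype.ext (hH0 v)
      map_one_left := fun v => rfl }

end FramedSphereFamily

end Literature.Topology.FourManifolds

end
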